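import Literature.Analysis.FunctionSpaces.HolderNorm
import Literature.Analysis.FunctionSpaces.TorusTestFunction
import Literature.Analysis.FunctionSpaces.TorusFluidGlue
import Literature.Analysis.FluidPDE.WeakSolution
import HarnessLib

/-!
# Globally dissipative (local-energy-inequality) weak Euler flows on `T^d`

Topic: Analysis/FluidPDE (Onsager theory / convex integration; companion of `Onsager.lean`, which
records Onsager *flexibility* — dissipative Hölder Euler flows with a prescribed total energy
profile, Isett 2018 / Buckmaster–De Lellis–Székelyhidi–Vicol 2019 — but nothing about the **local**
energy inequality).

## Contents

* `Torus.IsGloballyDissipativeEulerOn T u p` — the notion (Isett 2022, §1, p. 3; De Lellis–Kwon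
  2022, §1, p. 3): a distributional solution `(u, p)` of incompressible Euler on `(0,T) × T^d` with
  `u ∈ L³_{t,x}`, `p ∈ L^{3/2}_{t,x}` which satisfies the **local energy inequality**
  `∂ₜ(½|u|²) + ∇·((½|u|² + p) u) ≤ 0` in `𝒟'((0,T) × T^d)`, i.e. tested against every nonnegative
  smooth `ψ` compactly supported in time in `(0,T)`:
  `0 ≤ ∫₀ᵀ∫ ½|u|² ∂ₜψ + (½|u|² + p) ⟪u, ∇ψ⟫`. The integrand is character-for-character that of the
  tree's `Torus.energyFluxFunctional T u p ψ` (`EyinkUniformDefectOfEuler`) and of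
  `Torus.HasLocalEnergyBalance T 0 u p G D` (`DissipationAnomaly`), so the inequality reads
  `0 ≤ energyFluxFunctional T u p ψ` by `rfl`; by Duchon–Robert 2000, Prop. 2 (named fact
  `FluidPDE.duchon_robert_defect_exists`, uniqueness `Torus.HasDuchonRobertDefect.unique`) it is the
  statement that the Duchon–Robert defect `D(u)` is a nonnegative distribution — the currency of the
  EulerLimit route items of the AnomalousDissipation summit.
* `Torus.DeLellisKwon2022_thm11` — **named fact** (De Lellis–Kwon, Anal. PDE 15 (2022), Thm. 1.1):
  for every `0 ≤ β < 1/7` and every `T > 0` there is a globally dissipative weak Euler flow on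
  `[0,T] × T³` of class `C^β([0,T] × T³)` whose total kinetic energy strictly drops,
  `½∫|u(T)|² < ½∫|u(0)|²`.

## Why it is here (grounding record)

Vendored while grounding `Summit.AnomalousDissipation.AnomalousDissipation.Theses.EulerLimit.
GloballyDissipativePeriodicEulerFlow` (stmt-AnomalousDissipation-1516) and
`….VanishingViscosityRealizationV2` (stmt-AnomalousDissipation-1507): the nearest PRINTED existence
theorem for Euler flows with a nonnegative Duchon–Robert defect. It does **not** close either item —
the printed flows are unforced, live on a finite window and are not time-periodic, whereas the items
ask for a steady smooth force, `τ`-periodicity and positive period input; it is recorded as the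
prior art / hypothesis a prover may cite. Related printed results NOT vendored here: Isett, Arch.
Ration. Mech. Anal. 244 (2022) = arXiv:1710.11186, Thm. 1 (Hölder globally dissipative flows on
`(0,∞) × T^d`, `d ≥ 3`, strict inequality on an open time interval) and Thm. 4 (`C^{1/15−}_{t,x}`,
compact support in time, common dissipation measure); Giri–Kwon–Novack, arXiv:2305.18509, Thm. 1.1
(the `L³`-based classes `C⁰_t B^{1/3−}_{3,∞}`); Isett 2022, Conjecture 1 (inviscid K41–Onsager:
`L^∞_t C^{1/3}_x` with nonzero local dissipation) — open.

## Design choices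

* Pressure-explicit, exactly as printed ("a weak solution `(v,p)` … of class `v ∈ L³_{t,x}`
  [hence `p ∈ L^{3/2}_{t,x}` by Calderón–Zygmund] satisfying the local energy inequality"): the
  solution notion is the tree's `Torus.IsDistributionalNSSolutionOn T 0 0 u p` (CKN (2.1)–(2.2) on
  the torus, `ν = 0`, `f = 0`). Any two pressures of the same distributional solution differ by a
  function of time alone, which does not change the inequality (`u` is weakly divergence free), so
  no Poisson normalisation of `p` is imposed.
* Hölder regularity on `[0,T] × T³` is the tree's `FunctionSpaces.HolderOnSpaceTime β T u`
  (product sup-metric), as in `onsager_flexibility`; `β : ℝ≥0` (Mathlib Hölder convention). For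
  `β = 0` the class only records boundedness, which the printed continuous solutions have.
* Energies are the tree's `FunctionSpaces.Torus.kineticEnergy` (Bochner; no junk for continuous
  slices).
* Nothing is proved here; no new analysis is defined beyond the one predicate.

## References

* C. De Lellis, H. Kwon, *On nonuniqueness of Hölder continuous globally dissipative Euler flows*,
  Anal. PDE 15 (2022) 2003–2059 = arXiv:2006.06482: §1 p. 3 (definitions (EI), (Onsager)),
  Thm. 1.1, Thm. 1.2. [DelellisKwon2022]
* P. Isett, *Nonuniqueness and existence of continuous, globally dissipative Euler flows*, Arch.
  Ration. Mech. Anal. 244 (2022) = arXiv:1710.11186: §1 p. 3 (definition), Thms. 1, 4, Conj. 1–2.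
* J. Duchon, R. Robert, Nonlinearity 13 (2000) 249–255, Prop. 2. [DuchonRobert2000]
-/

noncomputable section

open MeasureTheory Set Filter
open scoped InnerProductSpace RealInnerProductSpace ENNReal NNReal

namespace Literature.Analysis.FluidPDE.Torus

variable {d : Type*} [Fintype d] [DecidableEq d]

/-- **Globally dissipative weak Euler flows** (Isett 2022, §1, p. 3; De Lellis–Kwon 2022, §1,
p. 3, (EI)). `(u, p)` is a distributional solution of incompressible Euler on `(0,T) × T^d`
(`Torus.IsDistributionalNSSolutionOn T 0 0 u p`: momentum equation against all smooth vector tests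
compactly supported in time, weak incompressibility, `u ∈ L²`, `p ∈ L¹`), of class
`u ∈ L³((0,T) × T^d)`, `p ∈ L^{3/2}((0,T) × T^d)`, satisfying the **local energy inequality**
`∂ₜ(½|u|²) + ∇·((½|u|² + p) u) ≤ 0` in the sense of distributions: for every smooth scalar test
function `ψ ≥ 0` compactly supported in time in `(0,T)`,
`0 ≤ ∫₀ᵀ∫ ½|u|² ∂ₜψ + (½|u|² + p) ⟪u, ∇ψ⟫` (the integrand of `Torus.energyFluxFunctional` /
`Torus.HasLocalEnergyBalance` with `ν = 0`, verbatim). De Lellis–Kwon: "A globally dissipative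
Euler flow is a distributional solution which belongs [to] `L³([0,T] × T³)` and satisfies
additionally the local energy inequality (EI)". [cite: DelellisKwon2022, §1 p. 3 (EI)] -/
def IsGloballyDissipativeEulerOn (T : ℝ) (u : ℝ → UnitAddTorus d → EuclideanSpace ℝ d)
    (p : ℝ → UnitAddTorus d → ℝ) : Prop :=
  IsDistributionalNSSolutionOn T 0 0 u p ∧
    (∫⁻ t in Ioo 0 T, ∫⁻ x, ‖u t x‖ₑ ^ (3 : ℕ) < ∞) ∧
    (∫⁻ t in Ioo 0 T, ∫⁻ x, ‖p t x‖ₑ ^ (3 / 2 : ℝ) < ∞) ∧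
    ∀ ψ : ℝ → UnitAddTorus d → ℝ, FunctionSpaces.Torus.IsSpaceTimeTestIoo T ψ → (∀ t x, 0 ≤ ψ t x) →
      0 ≤ ∫ t in Ioo 0 T, ∫ x, (2⁻¹ * ‖u t x‖ ^ 2 * FunctionSpaces.Torus.timeDeriv ψ t x +
        (2⁻¹ * ‖u t x‖ ^ 2 + p t x) * ⟪u t x, FunctionSpaces.Torus.gradient (ψ t) x⟫_ℝ)

/-- Projection: a globally dissipative Euler flow is a distributional Euler solution. [folklore] -/
theorem IsGloballyDissipativeEulerOn.isDistributionalNSSolutionOn {T : ℝ}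
    {u : ℝ → UnitAddTorus d → EuclideanSpace ℝ d} {p : ℝ → UnitAddTorus d → ℝ}
    (h : IsGloballyDissipativeEulerOn T u p) : IsDistributionalNSSolutionOn T 0 0 u p :=
  h.1

/-- Projection: the local energy inequality of a globally dissipative Euler flow, tested against a
nonnegative test function supported in `(0,T)`. [folklore] -/
theorem IsGloballyDissipativeEulerOn.localEnergyIneq {T : ℝ}
    {u : ℝ → UnitAddTorus d → EuclideanSpace ℝ d} {p : ℝ → UnitAddTorus d → ℝ}
    (h : IsGloballyDissipativeEulerOn T u p) {ψ : ℝ → UnitAddTorus d → ℝ}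
    (hψ : FunctionSpaces.Torus.IsSpaceTimeTestIoo T ψ) (hψ0 : ∀ t x, 0 ≤ ψ t x) :
    0 ≤ ∫ t in Ioo 0 T, ∫ x, (2⁻¹ * ‖u t x‖ ^ 2 * FunctionSpaces.Torus.timeDeriv ψ t x +
        (2⁻¹ * ‖u t x‖ ^ 2 + p t x) * ⟪u t x, FunctionSpaces.Torus.gradient (ψ t) x⟫_ℝ) :=
  h.2.2.2 ψ hψ hψ0

/-- **Named fact** (De Lellis–Kwon, Anal. PDE 15 (2022), Thm. 1.1, verbatim: "For any
`0 ≤ β < 1/7` there are globally dissipative weak solutions `v` to the Euler equation (E) in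
`C^β([0,T] × T³)` for which (Onsager) holds", where (E) is incompressible Euler on `[0,T] × T³`,
`0 < T < ∞` arbitrary, and (Onsager) is `∫ ½|v|²(T,x) dx < ∫ ½|v|²(0,x) dx`). Lean reading: for
every `β : ℝ≥0` with `β < 1/7` and every `T > 0` there are `u : ℝ → T³ → ℝ³` and a pressure `p`
with `IsGloballyDissipativeEulerOn T u p`, `u ∈ C^β([0,T] × T³)` for the product sup-metric
(`FunctionSpaces.HolderOnSpaceTime β T u`), and `kineticEnergy (u T) < kineticEnergy (u 0)`.
Improves Isett 2022 (arXiv:1710.11186), Thms. 1 and 4 (`β < 1/15`); the conjectural threshold is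
`1/3` (Isett 2022, Conj. 1). Grounds (as nearest printed prior art, not as a proof) the EulerLimit
route items `Summit.AnomalousDissipation.AnomalousDissipation.Theses.EulerLimit.GloballyDissipativePeriodicEulerFlow`
and `….VanishingViscosityRealizationV2`, which ask in addition for a steady smooth force,
time-periodicity and positive period input. [cite: DelellisKwon2022, Thm. 1.1] -/
def DeLellisKwon2022_thm11 : Prop :=
  ∀ (β : ℝ≥0), β < 1 / 7 → ∀ (T : ℝ), 0 < T →
    ∃ (u : ℝ → UnitAddTorus (Fin 3) → EuclideanSpace ℝ (Fin 3)) (p : ℝ → UnitAddTorus (Fin 3) → ℝ),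
      IsGloballyDissipativeEulerOn T u p ∧ FunctionSpaces.HolderOnSpaceTime β T u ∧
        FunctionSpaces.Torus.kineticEnergy (u T) < FunctionSpaces.Torus.kineticEnergy (u 0)

end Literature.Analysis.FluidPDE.Torus
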